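import Mathlib
import Literature.Geometry.Symplectic.JHolomorphicMap

/-!
# Stub `stub_zalcman` of line `Sketch` for crux `TameOrBrodyR4` (stmt-SmoothPoincare4-7826, route SullivanDual)

The elementary **Zalcman–Brody rescaling** of one entire `C^∞` flat-`J`-holomorphic map
`f : ℂ → ℝ⁴` with `f(D̄) ⊆ K` and `df(0) ≠ 0`.  Maximise the weighted derivative
`φ(ξ) = (1 - ‖ξ‖) ‖df(ξ)‖` over the closed unit disc (compact, and `φ` is continuous because `f`
is `C¹`), say at `ξ₀`, and put `M := φ(ξ₀) ≥ φ(0) = ‖df(0)‖ > 0`, `ρ := 1 / ‖df(ξ₀)‖ > 0` and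
`g(ζ) := f(ξ₀ + ρ ζ)`.  By the chain rule `dg(ζ) = ρ • df(ξ₀ + ρ ζ)`; hence `g` is `C^∞`,
flat-`J`-holomorphic (each `J_x` is linear) and `‖dg(0)‖ = 1`.  For `‖ζ‖ ≤ M / 2` the point
`ξ₀ + ρ ζ` has norm `≤ ‖ξ₀‖ + (1 - ‖ξ₀‖) / 2 ≤ 1`, so `g(ζ) ∈ K`, and maximality of `φ` at `ξ₀`
gives `‖df(ξ₀ + ρ ζ)‖ ≤ 2 ‖df(ξ₀)‖`, i.e. `‖dg(ζ)‖ ≤ 2`.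

References: L. Zalcman, *A heuristic principle in complex function theory*, Amer. Math. Monthly
82 (1975); R. Brody, *Compact manifolds and hyperbolicity*, Trans. AMS 235 (1978); for
`J`-curves B. Kruglikov, M. Overholt, Diff. Geom. Appl. 11 (1999), Thm 2.2.  Uses Mathlib only
(`IsCompact.exists_isMaxOn`, `isCompact_closedBall`, the chain rule `HasFDerivAt.comp`) and the
definition `Literature.Geometry.Symplectic.IsJHolomorphicFlat`.
-/

open scoped ContDiff Topology
open Filter Set Metric Literature.Geometry.Symplectic

-- the registered namespace `Summit.SmoothPoincare4.SmoothPoincare4.…` repeats a component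
set_option linter.dupNamespace false

namespace Summit.SmoothPoincare4.SmoothPoincare4.Cruxes.TameOrBrodyR4.Sketch

/-- Local notation for the model space `ℝ⁴ = EuclideanSpace ℝ (Fin 4)` (as in the registered
signature of the stub). -/
local notation "E4" => EuclideanSpace ℝ (Fin 4)

namespace Zalcman

variable {E : Type*} [NormedAddCommGroup E] [NormedSpace ℝ E]

/-- Chain rule for a real affine reparametrisation of the source: for a differentiable
`f : ℂ → E`, the map `η ↦ f (ξ + ρ • η)` has derivative `ρ • df(ξ + ρ • ζ)` at `ζ`. -/
theorem hasFDerivAt_comp_affine {f : ℂ → E} (hf : Differentiable ℝ f) (ξ : ℂ) (ρ : ℝ) (ζ : ℂ) :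
    HasFDerivAt (fun η : ℂ => f (ξ + ρ • η)) (ρ • fderiv ℝ f (ξ + ρ • ζ)) ζ := by
  have haff : HasFDerivAt (fun η : ℂ => ξ + ρ • η) (ρ • ContinuousLinearMap.id ℝ ℂ) ζ :=
    ((hasFDerivAt_id ζ).const_smul ρ).const_add ξ
  have hlin : (fderiv ℝ f (ξ + ρ • ζ)).comp (ρ • ContinuousLinearMap.id ℝ ℂ) =
      ρ • fderiv ℝ f (ξ + ρ • ζ) := by
    ext η
    simp
  have hcomp := (hf (ξ + ρ • ζ)).hasFDerivAt.comp ζ haff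
  rw [hlin] at hcomp
  exact hcomp

/-- The derivative of the affine reparametrisation `η ↦ f (ξ + ρ • η)` is `ρ • df(ξ + ρ • ζ)`. -/
theorem fderiv_comp_affine {f : ℂ → E} (hf : Differentiable ℝ f) (ξ : ℂ) (ρ : ℝ) (ζ : ℂ) :
    fderiv ℝ (fun η : ℂ => f (ξ + ρ • η)) ζ = ρ • fderiv ℝ f (ξ + ρ • ζ) :=
  (hasFDerivAt_comp_affine hf ξ ρ ζ).fderiv

/-- Norm of the derivative of the affine reparametrisation, for a scale `ρ ≥ 0`. -/
theorem norm_fderiv_comp_affine {f : ℂ → E} (hf : Differentiable ℝ f) (ξ : ℂ) {ρ : ℝ}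
    (hρ : 0 ≤ ρ) (ζ : ℂ) :
    ‖fderiv ℝ (fun η : ℂ => f (ξ + ρ • η)) ζ‖ = ρ * ‖fderiv ℝ f (ξ + ρ • ζ)‖ := by
  rw [fderiv_comp_affine hf, norm_smul, Real.norm_of_nonneg hρ]

/-- A real affine reparametrisation of the source preserves flat `J`-holomorphicity
(`J_x` is linear, so it commutes with the scalar `ρ`). -/
theorem isJHolomorphicFlat_comp_affine {J : E → E →L[ℝ] E} {f : ℂ → E}
    (hf : Differentiable ℝ f) (hfJ : IsJHolomorphicFlat J f) (ξ : ℂ) (ρ : ℝ) :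
    IsJHolomorphicFlat J (fun η : ℂ => f (ξ + ρ • η)) := by
  intro z ζ
  have h := hfJ (ξ + ρ • z) ζ
  simp only [fderiv_comp_affine hf, smul_apply]
  rw [h, (J _).map_smul]

/-- A real affine reparametrisation of a `C^n` map is `C^n`. -/
theorem contDiff_comp_affine {f : ℂ → E} {n : WithTop ℕ∞} (hf : ContDiff ℝ n f) (ξ : ℂ) (ρ : ℝ) :
    ContDiff ℝ n (fun η : ℂ => f (ξ + ρ • η)) :=
  hf.comp (contDiff_const.add (contDiff_const_smul ρ))

/-- `‖ξ + ρ • ζ‖ ≤ ‖ξ‖ + ρ ‖ζ‖` for `ρ ≥ 0`. -/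
theorem norm_affine_le (ξ ζ : ℂ) {ρ : ℝ} (hρ : 0 ≤ ρ) : ‖ξ + ρ • ζ‖ ≤ ‖ξ‖ + ρ * ‖ζ‖ := by
  calc ‖ξ + ρ • ζ‖ ≤ ‖ξ‖ + ‖ρ • ζ‖ := norm_add_le _ _
    _ = ‖ξ‖ + ρ * ‖ζ‖ := by rw [norm_smul, Real.norm_of_nonneg hρ]

end Zalcman

/-- **Zalcman–Brody rescaling (stub `stub_zalcman`).** An entire `C^∞` flat-`J`-holomorphic
`f : ℂ → ℝ⁴` mapping the closed unit disc into `K`, with `df(0) ≠ 0`, has an affine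
reparametrisation `g = f(ξ₀ + ρ ·)` which is `C^∞`, flat-`J`-holomorphic, normalised by
`‖dg(0)‖ = 1`, and satisfies `g(ζ) ∈ K` and `‖dg(ζ)‖ ≤ 2` on the disc `‖ζ‖ ≤ M / 2`, where
`M = max_{‖ξ‖ ≤ 1} (1 - ‖ξ‖) ‖df(ξ)‖ ≥ ‖df(0)‖` (Zalcman 1975; Brody 1978). -/
theorem stub_zalcman (J : E4 → E4 →L[ℝ] E4) (K : Set E4) (f : ℂ → E4)
    (hf : ContDiff ℝ ∞ f) (hfJ : IsJHolomorphicFlat J f) (hfK : ∀ z : ℂ, ‖z‖ ≤ 1 → f z ∈ K)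
    (h0 : fderiv ℝ f 0 ≠ 0) :
    ∃ (g : ℂ → E4) (M : ℝ), ‖fderiv ℝ f 0‖ ≤ M ∧ ContDiff ℝ ∞ g ∧ IsJHolomorphicFlat J g ∧
      (∀ ζ : ℂ, ‖ζ‖ ≤ M / 2 → g ζ ∈ K) ∧ ‖fderiv ℝ g 0‖ = 1 ∧
      (∀ ζ : ℂ, ‖ζ‖ ≤ M / 2 → ‖fderiv ℝ g ζ‖ ≤ 2) := by
  have hdiff : Differentiable ℝ f := hf.differentiable (by simp)
  -- the weighted derivative `φ ξ = (1 - ‖ξ‖) ‖df ξ‖` is continuous; maximise it on the closed disc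
  have hφc : Continuous fun ξ : ℂ => (1 - ‖ξ‖) * ‖fderiv ℝ f ξ‖ :=
    (continuous_const.sub continuous_norm).mul (hf.continuous_fderiv (by simp)).norm
  obtain ⟨ξ₀, hξ₀, hmax⟩ := (isCompact_closedBall (0 : ℂ) 1).exists_isMaxOn
    ⟨0, mem_closedBall_self zero_le_one⟩ hφc.continuousOn
  rw [isMaxOn_iff] at hmax
  rw [mem_closedBall_zero_iff] at hξ₀
  -- abbreviations: `a = 1 - ‖ξ₀‖`, `D = ‖df ξ₀‖`, `M = a * D`, `ρ = D⁻¹`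
  obtain ⟨a, ha⟩ : ∃ a : ℝ, a = 1 - ‖ξ₀‖ := ⟨_, rfl⟩
  obtain ⟨D, hD⟩ : ∃ D : ℝ, D = ‖fderiv ℝ f ξ₀‖ := ⟨_, rfl⟩
  have hmax' : ∀ w : ℂ, ‖w‖ ≤ 1 → (1 - ‖w‖) * ‖fderiv ℝ f w‖ ≤ a * D := fun w hw => by
    rw [ha, hD]
    exact hmax w (mem_closedBall_zero_iff.mpr hw)
  have hM0 : ‖fderiv ℝ f 0‖ ≤ a * D := by
    have := hmax' 0 (by simp)
    simpa using this
  have hMpos : 0 < a * D := (norm_pos_iff.mpr h0).trans_le hM0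
  have ha0 : 0 ≤ a := by rw [ha]; linarith
  have hD0 : 0 ≤ D := by rw [hD]; exact norm_nonneg _
  have hapos : 0 < a := lt_of_le_of_ne ha0 fun h => by
    rw [← h, zero_mul] at hMpos
    exact lt_irrefl 0 hMpos
  have hDpos : 0 < D := lt_of_le_of_ne hD0 fun h => by
    rw [← h, mul_zero] at hMpos
    exact lt_irrefl 0 hMpos
  obtain ⟨ρ, hρ⟩ : ∃ ρ : ℝ, ρ = D⁻¹ := ⟨_, rfl⟩
  have hρpos : 0 < ρ := by rw [hρ]; exact inv_pos.mpr hDpos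
  have hρD : ρ * D = 1 := by rw [hρ]; exact inv_mul_cancel₀ hDpos.ne'
  have hρM : ρ * (a * D / 2) = a / 2 := by
    rw [hρ]
    field_simp
  -- the disc `‖ζ‖ ≤ M / 2` is mapped into the disc `‖ξ‖ ≤ ‖ξ₀‖ + a / 2 ≤ 1`
  have hw : ∀ ζ : ℂ, ‖ζ‖ ≤ a * D / 2 → ‖ξ₀ + ρ • ζ‖ ≤ ‖ξ₀‖ + a / 2 := fun ζ hζ => by
    calc ‖ξ₀ + ρ • ζ‖ ≤ ‖ξ₀‖ + ρ * ‖ζ‖ := Zalcman.norm_affine_le ξ₀ ζ hρpos.le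
      _ ≤ ‖ξ₀‖ + ρ * (a * D / 2) := by gcongr
      _ = ‖ξ₀‖ + a / 2 := by rw [hρM]
  have hw1 : ∀ ζ : ℂ, ‖ζ‖ ≤ a * D / 2 → ‖ξ₀ + ρ • ζ‖ ≤ 1 := fun ζ hζ => by
    have := hw ζ hζ
    linarith
  refine ⟨fun η => f (ξ₀ + ρ • η), a * D, hM0, Zalcman.contDiff_comp_affine hf ξ₀ ρ,
    Zalcman.isJHolomorphicFlat_comp_affine hdiff hfJ ξ₀ ρ, fun ζ hζ => hfK _ (hw1 ζ hζ), ?_,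
    fun ζ hζ => ?_⟩
  · -- `‖dg(0)‖ = ρ ‖df(ξ₀)‖ = 1`
    rw [Zalcman.norm_fderiv_comp_affine hdiff ξ₀ hρpos.le, smul_zero, add_zero, ← hD, hρD]
  · -- `‖dg(ζ)‖ = ρ ‖df(ξ₀ + ρ ζ)‖ ≤ ρ · 2 D = 2` by maximality of `φ` at `ξ₀`
    rw [Zalcman.norm_fderiv_comp_affine hdiff ξ₀ hρpos.le]
    have h1 := hmax' _ (hw1 ζ hζ)
    have h2 : a / 2 ≤ 1 - ‖ξ₀ + ρ • ζ‖ := by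
      have := hw ζ hζ
      linarith
    have h3 : a / 2 * ‖fderiv ℝ f (ξ₀ + ρ • ζ)‖ ≤ a / 2 * (2 * D) :=
      calc a / 2 * ‖fderiv ℝ f (ξ₀ + ρ • ζ)‖
          ≤ (1 - ‖ξ₀ + ρ • ζ‖) * ‖fderiv ℝ f (ξ₀ + ρ • ζ)‖ :=
            mul_le_mul_of_nonneg_right h2 (norm_nonneg _)
        _ ≤ a * D := h1
        _ = a / 2 * (2 * D) := by ring
    have h4 : ‖fderiv ℝ f (ξ₀ + ρ • ζ)‖ ≤ 2 * D := le_of_mul_le_mul_left h3 (half_pos hapos)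
    calc ρ * ‖fderiv ℝ f (ξ₀ + ρ • ζ)‖ ≤ ρ * (2 * D) := mul_le_mul_of_nonneg_left h4 hρpos.le
      _ = 2 := by rw [mul_left_comm, hρD, mul_one]

end Summit.SmoothPoincare4.SmoothPoincare4.Cruxes.TameOrBrodyR4.Sketch
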